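import Summits.BirchSwinnertonDyer.BirchSwinnertonDyer.Theorems.EisensteinPrimesMazurMCOnX1RankZeroInterludeRoadBResiduePKernelModule
import Summits.BirchSwinnertonDyer.BirchSwinnertonDyer.Theorems.EisensteinPrimesMazurMCOnX1RankZeroInterludeSelmerIsogenyMaps
import Summits.BirchSwinnertonDyer.BirchSwinnertonDyer.Theorems.AlignedTransportAtTwoMainConjectureOfRankZeroBSDAtTwoFineRoadCokerAtTwo
import Summits.BirchSwinnertonDyer.BirchSwinnertonDyer.Theorems.ErratumRoadFiveTateTorsionRigidityPadicModel
import Summits.BirchSwinnertonDyer.BirchSwinnertonDyer.Theorems.SmallImageMuTransferMuTransferX9SelmerDualLocalFineNil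
import Literature.NumberTheory.EllipticCurves.BigRepModuleShapiroSelmerConditionsProofs
import Literature.NumberTheory.DiophantineGeometry.LocalReductionFiniteBadPlacesProofs
import HarnessLib

/-!
# Crux `MazurMCOnX1RankZero` (item stmt-BirchSwinnertonDyer-19035), line `interlude_with_torsion`, road B (B1c) at
# degree exactly `p` GIVEN (B3): residual `GL(1)` finiteness ⟹ the Selmer map along ONE `ℚ`-isogeny of degree `p`
# has finite kernel (`kerSelmerMapFiniteOfDegreeP_of_residualGL1FinitenessOdd`)

Cell `bsd-eis` (host `run/shared/lean/pub/bsd-eis/`), LEAD `cruxlead-19035` (g0), stub worker on the registered stub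
`stub_roadBResidueP : RoadBResidueP := ResidualGL1FinitenessOdd → KerSelmerMapFiniteOfDegreeP` of skeleton v8
(`Cruxes/MazurMCOnX1RankZero/Lines/interlude_with_torsion.lean`); `--supports` stmt-BirchSwinnertonDyer-19035 as a HELPER.
The skeleton's two `def … : Prop` currencies are not importable from `Theorems/`, so the main theorem below carries the
body of `ResidualGL1FinitenessOdd` token for token as its HYPOTHESIS `hGL1` ((B3) — NOT proved, NOT asserted here; it is the
neighbouring registered stub `stub_residualGL1FinitenessOdd`) and the body of `KerSelmerMapFiniteOfDegreeP` token for token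
as its conclusion; the lead folds it into the skeleton by definitional unfolding. Content = sections Assembly / Instantiation /
Core of the companion workfile `Cruxes/MazurMCOnX1RankZero/Lines/interlude_stepsTwoThree_split_idea11g6_roadB_helpers.lean`
(rev 2, ideator bsd-idea-11 g16, sorry-free there; blueprint memo `Lines/interlude_K2mu_ArnoldKoo_memo_idea11g14.md` §10),
recomposed over the landed pieces (R1)–(R4) (`…InterludeRoadBResiduePKernelModule`), (R3-alg)/CL
(`…InterludeRoadBLocalIndex`) and the tree's `conjH1_mem_awayKer_of_mem_decomp` / `forall_conjH1_mem_awayKer_iff`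
(`…FineRoadCokerAtTwo` §1), `BigGaloisRep.strictKer_strictDatum_eq_awayKer`, `TateTorsionRigidity.geomPointsExtend_absGaloisRestrict_smul`,
`SelmerDual.resH1Hom_id_conjH1`. NOTHING is asserted about BSD, Mazur's main conjecture or IMC2: the file proves an
IMPLICATION whose hypothesis (B3) is OPEN in the tree.

WHAT.
* **(R5)/(R6) abstract** `RoadBHelpers.finite_selmerAc_inter_ker_h1Map`: `K` quadratic, `p = v v̄` split, `κ` cyclotomic,
  `ψ : W → W'` a `K`-isogeny of degree `p`, `ι : S ↪ W[p^∞]` injective equivariant with image `W[ψ]`; IF Greenberg's residual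
  strict Selmer group `datumStrictSelmer (ker κ) S p (bdpData S p v̄) (bad places of W)` is finite THEN
  `{c ∈ Sel_{v̄}(K_∞, W[p^∞]) | ψ_* c = 0}` is finite ((R1): `c = ι_* d`; (R4)+(R2): `ι_*⁻¹ Sel ∩ (trivial above v̄) ⊆`
  the residual group; (R3): finite image in the local kernel above `v̄`; finite kernel-part + finite image ⟹ finite).
* **Instantiation** `S := E[ψ₀] ⊆ E(ℚ̄)` for `ψ₀ : W → W'` over `ℚ`, `Γ_K` acting through `res : Γ_K → Γ_ℚ`
  (`RoadBHelpers.kerResAction`, a reducible def of class type supplied by `letI`, never an instance — so the provenance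
  binder `σ • m = absGaloisRestrict ℚ K σ • m` of (B3) holds by `rfl`), `ι := RoadBHelpers.kerToPrimary` (transport of
  points along the tree's chosen `ℚ̄ ≃ K̄`), `#E[ψ₀] = deg ψ₀ = p`:
  `RoadBHelpers.finite_selmerAc_inter_ker_h1Map_extendScalars`.
* **Main theorem** `kerSelmerMapFiniteOfDegreeP_of_residualGL1FinitenessOdd`: `hGL1` at `M := E[ψ₀]`, `S :=` the bad
  places of `W_K` (`finite_badPlaces_holds`); the kernel of `K2e.acSelmerMap p κ v̄ ∅ (ψ₀,K)_* _` injects into the finite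
  set by `K2e.coe_acSelmerMap_apply` (`rfl`). The two `HasGoodReductionAtPrime p` binders of the conclusion are not used.
References: Greenberg, LNM 1716 §5 (proof of Prop. 5.10); Greenberg–Vatsal 2000 §2 (proof of Prop. 2.8); Castella 2018
Def. 2.2; Silverman AEC III.§4, VII.§4, X.§4.
-/

set_option linter.dupNamespace false
set_option autoImplicit false

noncomputable section

open scoped Classical

namespace Summit.BirchSwinnertonDyer.BirchSwinnertonDyer.Theorems.InterludeWithTorsion

open AddSubgroup Field WeierstrassCurve NumberField IsDedekindDomain
  Literature.NumberTheory.EllipticCurves Literature.NumberTheory.EllipticCurves.GreenbergSelmer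
  Literature.NumberTheory.GaloisRepresentations Literature.NumberTheory.EllipticCurves.IsogenySelmerInfty
  Literature.NumberTheory.EllipticCurves.Castella2018 Literature.NumberTheory.EllipticCurves.Castella2018.AcSelmer
  Summit.BirchSwinnertonDyer.BirchSwinnertonDyer.Theorems.AlignedTransportAtTwoFineRoad

namespace RoadBHelpers

universe u

/-! ## (R5)/(R6): assembly over an abstract kernel module -/

section Assembly

variable {K : Type} [Field K] [NumberField K] {W W' : WeierstrassCurve K} [W.IsElliptic] [W'.IsElliptic]
  (p : ℕ) [hp : Fact p.Prime] (ψ : Isogeny W W')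
  {S : Type} [AddCommGroup S] [DistribMulAction (absoluteGaloisGroup K) S] [TopologicalSpace S] [DiscreteTopology S]
  (ι : S →+ ↥(geomPrimaryTorsion W p))

/-- **(R5)/(R6) Road B residue, abstract kernel module.** `K` quadratic, `p = v v̄` split, `κ` the cyclotomic `ℤ_p`-extension,
`ψ : W → W'` a `K`-isogeny of degree `p` of elliptic curves, `ι : S ↪ W[p^∞]` injective equivariant with image `W[ψ]`. IF the residual
Greenberg-strict Selmer group `Sel^{str}_{v̄}(K_∞, S)` (unramified outside `p` and the bad places of `W`, locally trivial above `v̄` —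
the instance of the line's `ResidualGL1FinitenessOdd` for `M = S`) is finite, THEN the classes of Castella's `Sel_{v̄}(K_∞, W[p^∞])`
killed by `ψ_*` form a finite set. Proof = memo §10: (R1) each such class is `ι_* d`; the `d` with `ι_* d ∈ Sel` form a subgroup `T`;
(R4)+(R2) `T ∩ (loc. trivial above v̄) ⊆ Sel^{str}_{v̄}(K_∞, S)` (finite); (R3) restriction to `ker κ ⊓ D_v̄` maps `T` into the finite
local kernel; a group with finite kernel-part and finite image is finite. No `μ = 0` input.
[cite: GreenbergVatsal2000, §2 pp. 23–27 (proof of Prop. 2.8)] [cite: GreenbergLNM1716, §5 Prop. 5.10] [cite: Castella2018, Def. 2.2] -/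
theorem finite_selmerAc_inter_ker_h1Map (hι : ∀ (σ : absoluteGaloisGroup K) (s : S), ι (σ • s) = σ • ι s)
    (hinj : Function.Injective ι)
    (hιψ : ∀ s : S, ψ ((ι s : geomPrimaryTorsion W p) : W.geomPoints) = 0)
    (hsurj : ∀ a : geomPrimaryTorsion W p, ψ (a : W.geomPoints) = 0 → ∃ s : S, ι s = a) (hdeg : ψ.degree = p)
    (hK2 : Module.finrank ℚ K = 2) {v vbar : HeightOneSpectrum (𝓞 K)} (hpv : ((p : ℕ) : 𝓞 K) ∈ v.asIdeal)
    (hpvbar : ((p : ℕ) : 𝓞 K) ∈ vbar.asIdeal) (hne : vbar ≠ v) (κ : ZpExtension K p) (hκ : κ.IsCyclotomic)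
    (hR : (GreenbergVatsal2000.datumStrictSelmer κ.kerSubgroup S p (bdpData S p vbar) (W.badPlaces (𝓞 K)) :
      Set (subgroupH1 κ.kerSubgroup S)).Finite) :
    {c : W.subgroupH1 p κ.kerSubgroup |
      c ∈ selmerAc W p κ vbar ∅ ∧ h1Map p κ.kerSubgroup ψ.toAddMonoidHom ψ.equivariant c = 0}.Finite := by
  classical
  -- `ι_*` on `H¹(ker κ, ·)` and the subgroup `T` of classes landing in `Sel`
  let ιH : subgroupH1 κ.kerSubgroup S →+ W.subgroupH1 p κ.kerSubgroup :=
    resH1Hom (ContinuousMonoidHom.id κ.kerSubgroup) ι (fun x s ↦ hι x s)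
  let T : AddSubgroup (subgroupH1 κ.kerSubgroup S) := (selmerAc W p κ vbar ∅).comap ιH
  -- (R1): every kernel class is `ι_*` of an element of `T`
  have hcover : {c : W.subgroupH1 p κ.kerSubgroup |
      c ∈ selmerAc W p κ vbar ∅ ∧ h1Map p κ.kerSubgroup ψ.toAddMonoidHom ψ.equivariant c = 0} ⊆ ιH '' (T : Set _) := by
    rintro c ⟨hc, hc0⟩
    obtain ⟨d, rfl⟩ := exists_resH1Hom_eq_of_h1Map_eq_zero p ψ ι hι hinj hsurj hdeg κ.kerSubgroup c hc0
    exact ⟨d, AddSubgroup.mem_comap.2 hc, rfl⟩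
  suffices hTfin : ((T : AddSubgroup (subgroupH1 κ.kerSubgroup S)) : Set (subgroupH1 κ.kerSubgroup S)).Finite from
    (hTfin.image ιH).subset hcover
  -- (R4)+(R2): `T ∩ (locally trivial above v̄) ⊆ Sel^{str}`
  have hgen := exists_mem_decomp_inv_mul_mem_kerSubgroup hK2 hpv hpvbar hne κ hκ
  have hTR : ∀ d ∈ T, d ∈ awayKer κ.kerSubgroup S vbar →
      d ∈ GreenbergVatsal2000.datumStrictSelmer κ.kerSubgroup S p (bdpData S p vbar) (W.badPlaces (𝓞 K)) := by
    intro d hdT hdv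
    have hsel : ιH d ∈ selmerAc W p κ vbar ∅ := AddSubgroup.mem_comap.1 hdT
    rw [selmerAc, mem_selmerOver_iff] at hsel
    rw [GreenbergVatsal2000.mem_datumStrictSelmer_iff]
    refine ⟨?_, fun u hu σ ↦ ?_⟩
    · rw [GreenbergVatsal2000.mem_unramifiedOutside_iff]
      intro u huS hpu σ
      have hu : W.HasGoodReductionAt u := by
        by_contra hbad
        exact huS hbad
      have h1 := hsel.1 u hpu (Set.notMem_empty u) σ
      have h2 : ιH (conjH1 κ.kerSubgroup S σ d) ∈ awayKer κ.kerSubgroup ↥(geomPrimaryTorsion W p) u := by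
        have e := Summit.BirchSwinnertonDyer.BirchSwinnertonDyer.Rank1Residual.SelmerDual.resH1Hom_id_conjH1
          κ.kerSubgroup ι hι σ d
        change ιH (conjH1 κ.kerSubgroup S σ d) = conjH1 κ.kerSubgroup _ σ (ιH d) at e
        rw [e]
        exact h1
      exact mem_unramifiedKer_of_resH1Hom_mem_awayKer p ι hι hinj κ.kerSubgroup hu hpu _ h2
    · by_cases huv : u = vbar
      · subst huv
        rw [bdpData_self, BigGaloisRep.strictKer_strictDatum_eq_awayKer]
        exact (CokerAtTwo.forall_conjH1_mem_awayKer_iff κ.kerSubgroup S hgen d).2 hdv σ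
      · rw [bdpData_of_ne _ _ hu huv, strictKer_relaxedDatum_eq_top]
        exact AddSubgroup.mem_top _
  have hKfin : {d : subgroupH1 κ.kerSubgroup S | d ∈ T ∧ d ∈ awayKer κ.kerSubgroup S vbar}.Finite :=
    hR.subset fun d hd ↦ hTR d hd.1 hd.2
  -- (R3): restriction to `G₀ = ker κ ⊓ D_v̄` maps `T` into the finite local kernel
  have hres : ∀ d ∈ T, resH1Hom (ContinuousMonoidHom.id ↥(κ.kerSubgroup ⊓ decomp vbar)) ι (fun x s ↦ hι x s)
      (resOfLe S (inf_le_left : κ.kerSubgroup ⊓ decomp vbar ≤ κ.kerSubgroup) d) = 0 := by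
    intro d hdT
    have hsel : ιH d ∈ selmerAc W p κ vbar ∅ := AddSubgroup.mem_comap.1 hdT
    rw [selmerAc, mem_selmerOver_iff] at hsel
    have h1 := hsel.2.2 1
    rw [Literature.NumberTheory.EllipticCurves.conjH1_one_holds κ.kerSubgroup, AddMonoidHom.id_apply,
      BigGaloisRep.strictKer_strictDatum_eq_awayKer, awayKer, AddMonoidHom.mem_ker] at h1
    rw [← resOfLe_resH1Hom_id (inf_le_left : κ.kerSubgroup ⊓ decomp vbar ≤ κ.kerSubgroup) ι hι d]
    exact h1
  -- finite kernel-part and finite image ⇒ `T` finite (cosets of `T ∩ ker` indexed by the image)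
  let g : subgroupH1 κ.kerSubgroup S →+ subgroupH1 (κ.kerSubgroup ⊓ decomp vbar) S :=
    resOfLe S (inf_le_left : κ.kerSubgroup ⊓ decomp vbar ≤ κ.kerSubgroup)
  have hIm : (g '' (T : Set (subgroupH1 κ.kerSubgroup S))).Finite :=
    (finite_ker_resH1Hom_id p ψ ι hι (κ.kerSubgroup ⊓ decomp vbar) hinj hιψ hsurj hdeg).subset (by
      rintro _ ⟨d, hd, rfl⟩
      exact hres d hd)
  have hK0 : {k : subgroupH1 κ.kerSubgroup S | k ∈ T ∧ g k = 0}.Finite :=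
    hKfin.subset fun k hk ↦ ⟨hk.1, by rw [awayKer, AddMonoidHom.mem_ker]; exact hk.2⟩
  let pre : subgroupH1 (κ.kerSubgroup ⊓ decomp vbar) S → subgroupH1 κ.kerSubgroup S := fun y ↦
    if hy : y ∈ g '' (T : Set (subgroupH1 κ.kerSubgroup S)) then hy.choose else 0
  have hpre : ∀ y ∈ g '' (T : Set (subgroupH1 κ.kerSubgroup S)), pre y ∈ T ∧ g (pre y) = y := by
    intro y hy
    have e : pre y = hy.choose := dif_pos hy
    rw [e]
    exact hy.choose_spec
  refine (hIm.biUnion fun y _ ↦ hK0.image fun k ↦ pre y + k).subset fun d hd ↦ ?_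
  have hy : g d ∈ g '' (T : Set (subgroupH1 κ.kerSubgroup S)) := Set.mem_image_of_mem g hd
  refine Set.mem_biUnion hy ⟨d - pre (g d), ⟨T.sub_mem hd (hpre _ hy).1, ?_⟩, ?_⟩
  · rw [map_sub, (hpre _ hy).2, sub_self]
  · change pre (g d) + (d - pre (g d)) = d
    abel

end Assembly

/-! ## Instantiation: `S := E[ψ₀] ⊆ E(ℚ̄)` with `Γ_K` acting through `res`, `ι :=` transport of points -/

section Instantiation

variable {W W' : WeierstrassCurve ℚ} (p : ℕ) (ψ₀ : Isogeny W W') (K : Type) [Field K] [NumberField K]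

/-- **The residual module `E[ψ₀]` as a `Γ_K`-module** through `res : Γ_K → Γ_ℚ` (`E[ψ₀] ⊆ E(ℚ̄)` with `Isogeny.kerAction`). A `def`
of class type (supplied by `letI`), reducible as Lean requires; never an instance. This is the `M` of the line's `ResidualGL1FinitenessOdd`
for road B, with the provenance `σ • m = res σ • m` holding by `rfl`. [cite: SilvermanAEC2009, X.§4 (Thm. X.4.2, the module `E[φ]`)] -/
abbrev kerResAction : DistribMulAction (absoluteGaloisGroup K) ↥ψ₀.toAddMonoidHom.ker :=
  letI := ψ₀.kerAction
  DistribMulAction.compHom ↥ψ₀.toAddMonoidHom.ker (absGaloisRestrict ℚ K).toMonoidHom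

/-- `E[ψ₀]` is killed by `p = deg ψ₀`, so its transport lies in `E_K[p^∞]`. [cite: SilvermanAEC2009, Thm. III.4.10 (a)] -/
theorem geomPointsExtend_ker_mem (hdeg : ψ₀.degree = p) (P : ↥ψ₀.toAddMonoidHom.ker) :
    W.geomPointsExtend K (Literature.NumberTheory.GaloisRepresentations.absClosureEquiv ℚ K) (P : W.geomPoints) ∈ geomPrimaryTorsion (W.baseChange K) p := by
  refine ⟨1, ?_⟩
  have hP : ψ₀ (P : W.geomPoints) = 0 := by
    have h := P.2
    rwa [AddMonoidHom.mem_ker, Isogeny.coe_toAddMonoidHom] at h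
  rw [pow_one, ← map_nsmul, nsmul_eq_zero_of_isogeny_apply_eq_zero p ψ₀ hdeg hP, map_zero]

/-- **`ι : E[ψ₀] → E_K[p^∞]`**, `P ↦ ι_* P` (transport along the chosen `ℚ̄ ≃ K̄`). [cite: SilvermanAEC2009, III.§2, X.§4] -/
def kerToPrimary (hdeg : ψ₀.degree = p) :
    ↥ψ₀.toAddMonoidHom.ker →+ ↥(geomPrimaryTorsion (W.baseChange K) p) where
  toFun P := ⟨W.geomPointsExtend K (Literature.NumberTheory.GaloisRepresentations.absClosureEquiv ℚ K) (P : W.geomPoints), geomPointsExtend_ker_mem p ψ₀ K hdeg P⟩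
  map_zero' := Subtype.ext (by simp)
  map_add' P Q := Subtype.ext (by simp)

/-- Unfolding `kerToPrimary`. [folklore] -/
theorem coe_kerToPrimary_apply (hdeg : ψ₀.degree = p) (P : ↥ψ₀.toAddMonoidHom.ker) :
    ((kerToPrimary p ψ₀ K hdeg P : geomPrimaryTorsion (W.baseChange K) p) : (W.baseChange K).geomPoints) =
      W.geomPointsExtend K (Literature.NumberTheory.GaloisRepresentations.absClosureEquiv ℚ K) (P : W.geomPoints) :=
  rfl

/-- `ι` is `Γ_K`-equivariant for the action through `res` (tree `TateTorsionRigidity.geomPointsExtend_absGaloisRestrict_smul`).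
[cite: SerreGaloisCohomology1997, I.§2.4] -/
theorem kerToPrimary_smul (hdeg : ψ₀.degree = p) (σ : absoluteGaloisGroup K) (P : ↥ψ₀.toAddMonoidHom.ker) :
    letI := kerResAction ψ₀ K
    kerToPrimary p ψ₀ K hdeg (σ • P) = σ • kerToPrimary p ψ₀ K hdeg P := by
  letI := kerResAction ψ₀ K
  apply Subtype.ext
  rw [coe_kerToPrimary_apply, primaryComponent.coe_smul, coe_kerToPrimary_apply]
  exact TateTorsionRigidity.geomPointsExtend_absGaloisRestrict_smul W K (Literature.NumberTheory.GaloisRepresentations.absClosureEquiv ℚ K)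
    (Literature.NumberTheory.GaloisRepresentations.absClosureEquiv_apply ℚ K) σ P

/-- `ι` is injective. [folklore] -/
theorem kerToPrimary_injective (hdeg : ψ₀.degree = p) : Function.Injective (kerToPrimary p ψ₀ K hdeg) := by
  intro P Q h
  have h' := congrArg (fun y : geomPrimaryTorsion (W.baseChange K) p ↦ (y : (W.baseChange K).geomPoints)) h
  simp only [coe_kerToPrimary_apply] at h'
  exact Subtype.ext ((W.geomPointsExtend K (Literature.NumberTheory.GaloisRepresentations.absClosureEquiv ℚ K)).injective h')

/-- `ψ₀,K ∘ ι = 0`. [cite: SilvermanAEC2009, III.§4 (p. 66)] -/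
theorem extendScalars_kerToPrimary (hdeg : ψ₀.degree = p) (P : ↥ψ₀.toAddMonoidHom.ker) :
    ψ₀.extendScalars K ((kerToPrimary p ψ₀ K hdeg P : geomPrimaryTorsion (W.baseChange K) p) :
      (W.baseChange K).geomPoints) = 0 := by
  have hP : ψ₀ (P : W.geomPoints) = 0 := by
    have h := P.2
    rwa [AddMonoidHom.mem_ker, Isogeny.coe_toAddMonoidHom] at h
  rw [coe_kerToPrimary_apply, Isogeny.extendScalars, Isogeny.extendScalarsOfAlgEquiv_apply_geomPointsExtend, hP, map_zero]

/-- The image of `ι` is `E_K[ψ₀,K] ∩ E_K[p^∞]` (indeed all of `E_K[ψ₀,K]`). [cite: SilvermanAEC2009, III.§4 (p. 66)] -/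
theorem exists_kerToPrimary_eq (hdeg : ψ₀.degree = p) (a : geomPrimaryTorsion (W.baseChange K) p)
    (ha : ψ₀.extendScalars K (a : (W.baseChange K).geomPoints) = 0) : ∃ P, kerToPrimary p ψ₀ K hdeg P = a := by
  set Q := (W.geomPointsExtend K (Literature.NumberTheory.GaloisRepresentations.absClosureEquiv ℚ K)).symm (a : (W.baseChange K).geomPoints) with hQ
  have haQ : (a : (W.baseChange K).geomPoints) = W.geomPointsExtend K (Literature.NumberTheory.GaloisRepresentations.absClosureEquiv ℚ K) Q := by
    rw [hQ, AddEquiv.apply_symm_apply]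
  have hQker : Q ∈ ψ₀.toAddMonoidHom.ker := by
    rw [haQ, Isogeny.extendScalars, Isogeny.extendScalarsOfAlgEquiv_apply_geomPointsExtend,
      AddEquiv.map_eq_zero_iff] at ha
    rwa [AddMonoidHom.mem_ker, Isogeny.coe_toAddMonoidHom]
  exact ⟨⟨Q, hQker⟩, Subtype.ext (by rw [coe_kerToPrimary_apply, haQ])⟩

/-- **Road B residue for `E[ψ₀]`, `deg ψ₀ = p`**: for `W, W'/ℚ` elliptic, `ψ₀ : W → W'` a `ℚ`-isogeny of degree `p`, `K` quadratic with
`p = v v̄` split, `κ` cyclotomic, IF the residual strict Selmer group of the `Γ_K`-module `E[ψ₀]` (strict above `v̄`, unramified outside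
`p` and the bad places of `W_K`; the `M := E[ψ₀]`, `S := bad places` instance of (B3)) is finite THEN the classes of Castella's
`Sel_{v̄}(K_∞, W_K[p^∞])` killed by `(ψ₀,K)_*` form a finite set. [cite: GreenbergVatsal2000, §2 (proof of Prop. 2.8)]
[cite: GreenbergLNM1716, §5 Prop. 5.10] -/
theorem finite_selmerAc_inter_ker_h1Map_extendScalars [W.IsElliptic] [W'.IsElliptic] [Fact p.Prime]
    (hdeg : ψ₀.degree = p) (hK2 : Module.finrank ℚ K = 2) {v vbar : HeightOneSpectrum (𝓞 K)}
    (hpv : ((p : ℕ) : 𝓞 K) ∈ v.asIdeal) (hpvbar : ((p : ℕ) : 𝓞 K) ∈ vbar.asIdeal) (hne : vbar ≠ v)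
    (κ : ZpExtension K p) (hκ : κ.IsCyclotomic)
    (hR : letI := kerResAction ψ₀ K
      (GreenbergVatsal2000.datumStrictSelmer κ.kerSubgroup ↥ψ₀.toAddMonoidHom.ker p
        (bdpData ↥ψ₀.toAddMonoidHom.ker p vbar) ((W.baseChange K).badPlaces (𝓞 K)) :
          Set (subgroupH1 κ.kerSubgroup ↥ψ₀.toAddMonoidHom.ker)).Finite) :
    {c : (W.baseChange K).subgroupH1 p κ.kerSubgroup | c ∈ selmerAc (W.baseChange K) p κ vbar ∅ ∧
      h1Map p κ.kerSubgroup (ψ₀.extendScalars K).toAddMonoidHom (ψ₀.extendScalars K).equivariant c = 0}.Finite := by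
  letI := kerResAction ψ₀ K
  exact finite_selmerAc_inter_ker_h1Map p (ψ₀.extendScalars K) (kerToPrimary p ψ₀ K hdeg) (kerToPrimary_smul p ψ₀ K hdeg)
    (kerToPrimary_injective p ψ₀ K hdeg) (extendScalars_kerToPrimary p ψ₀ K hdeg) (exists_kerToPrimary_eq p ψ₀ K hdeg)
    (by rw [Isogeny.degree_extendScalars]; exact hdeg) hK2 hpv hpvbar hne κ hκ hR

end Instantiation

end RoadBHelpers

/-! ## (B1c) at degree exactly `p` GIVEN (B3) — the stub `stub_roadBResidueP` unfolded -/

/-- **ROAD B RESIDUE AT DEGREE `p` (`stub_roadBResidueP : RoadBResidueP` of the line `interlude_with_torsion` v8, UNFOLDED):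
residual `GL(1)` finiteness ⟹ finite Selmer kernel along ONE `ℚ`-isogeny of degree exactly `p`.** The hypothesis `hGL1` is,
token for token, the body of the skeleton's `ResidualGL1FinitenessOdd` ((B3): for imaginary quadratic `K`, odd `p = v v̄` split,
cyclotomic `κ`, finite `S`, and an order-`p` discrete module `M` whose `Γ_K`-action is restricted from a `Γ_ℚ`-action, Greenberg's
residual strict Selmer group `datumStrictSelmer (ker κ) M p (bdpData M p v̄) S` is finite — NOT proved here, NOT asserted: it is the
neighbouring stub); the conclusion is, token for token, the body of `KerSelmerMapFiniteOfDegreeP`: for `W, W'/ℚ` elliptic with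
good reduction at an odd prime `p`, a `ℚ`-isogeny `ψ₀ : W → W'` of degree `p`, `K` imaginary quadratic with `p = v v̄`, `κ`
cyclotomic, the Selmer map `K2e.acSelmerMap p κ v̄ ∅ (ψ₀,K)_* _ : Sel_v̄(K_∞, W_K[p^∞]) → Sel_v̄(K_∞, W'_K[p^∞])` has FINITE kernel.
PROOF (memo §10 (R1)–(R6)): `hGL1` at `M := E[ψ₀]` (`Γ_K` through `res`, provenance `rfl`), `#M = deg ψ₀ = p`, `S :=` the bad
places of `W_K` (`finite_badPlaces_holds`), then `RoadBHelpers.finite_selmerAc_inter_ker_h1Map_extendScalars`, into whose finite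
set the kernel injects by `K2e.coe_acSelmerMap_apply`. The two good-reduction binders and `2 < p` (beyond `p ≠ 2`) are not used.
[cite: GreenbergLNM1716, §5, proof of Prop. 5.10] [cite: GreenbergVatsal2000, §2 (Prop. 2.8 and its proof)]
[cite: SilvermanAEC2009, VII.§4 Thm. VII.4.1, X.§4 Thm. X.4.2] -/
theorem kerSelmerMapFiniteOfDegreeP_of_residualGL1FinitenessOdd
    (hGL1 : ∀ (K : Type) [Field K] [NumberField K], IsImaginaryQuadratic K →
      ∀ (p : ℕ) [Fact p.Prime], p ≠ 2 →
      ∀ (κ : ZpExtension K p), κ.IsCyclotomic →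
      ∀ (v vbar : HeightOneSpectrum (𝓞 K)), ((p : ℕ) : 𝓞 K) ∈ v.asIdeal → ((p : ℕ) : 𝓞 K) ∈ vbar.asIdeal →
        vbar ≠ v →
      ∀ (S : Set (HeightOneSpectrum (𝓞 K))), S.Finite →
      ∀ (M : Type) [AddCommGroup M] [DistribMulAction (absoluteGaloisGroup ℚ) M]
        [DistribMulAction (absoluteGaloisGroup K) M] [TopologicalSpace M] [DiscreteTopology M],
        Nat.card M = p →
        (∀ (σ : absoluteGaloisGroup K) (m : M), σ • m = (absGaloisRestrict ℚ K σ) • m) →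
        (GreenbergVatsal2000.datumStrictSelmer κ.kerSubgroup M p (AcSelmer.bdpData M p vbar) S :
          Set (subgroupH1 κ.kerSubgroup M)).Finite) :
    ∀ (W W' : WeierstrassCurve ℚ) [W.IsElliptic] [W'.IsElliptic] (p : ℕ) [Fact p.Prime],
      2 < p → W.HasGoodReductionAtPrime p → W'.HasGoodReductionAtPrime p →
      ∀ (ψ₀ : Isogeny W W'), ψ₀.degree = p →
      ∀ (K : Type) [Field K] [NumberField K], IsImaginaryQuadratic K →
      ∀ (v vbar : HeightOneSpectrum (𝓞 K)),
        ((p : ℕ) : 𝓞 K) ∈ v.asIdeal → ((p : ℕ) : 𝓞 K) ∈ vbar.asIdeal → vbar ≠ v →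
      ∀ (κ : ZpExtension K p), κ.IsCyclotomic →
        Finite (Summit.BirchSwinnertonDyer.BirchSwinnertonDyer.Theorems.InterludeWithTorsion.K2e.acSelmerMap p κ vbar ∅
          (ψ₀.extendScalars K).toAddMonoidHom (ψ₀.extendScalars K).equivariant).ker := by
  intro W W' _ _ p _ hp2 _ _ ψ₀ hdeg K _ _ hK v vbar hpv hpvbar hne κ hκ
  letI := ψ₀.kerAction
  letI := RoadBHelpers.kerResAction ψ₀ K
  have hR := hGL1 K hK p hp2.ne' κ hκ v vbar hpv hpvbar hne ((W.baseChange K).badPlaces (𝓞 K))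
    ((W.baseChange K).finite_badPlaces_holds (𝓞 K)) ↥ψ₀.toAddMonoidHom.ker hdeg (fun _ _ ↦ rfl)
  have hfin := RoadBHelpers.finite_selmerAc_inter_ker_h1Map_extendScalars p ψ₀ K hdeg hK.1 hpv hpvbar hne κ hκ hR
  haveI := hfin.to_subtype
  refine Finite.of_injective
    (fun c ↦ (⟨((c.1 : selmerAc (W.baseChange K) p κ vbar ∅) : (W.baseChange K).subgroupH1 p κ.kerSubgroup),
        (c.1 : selmerAc (W.baseChange K) p κ vbar ∅).2,
        congrArg Subtype.val ((AddMonoidHom.mem_ker).1 c.2)⟩ :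
      {c : (W.baseChange K).subgroupH1 p κ.kerSubgroup | c ∈ selmerAc (W.baseChange K) p κ vbar ∅ ∧
        h1Map p κ.kerSubgroup (ψ₀.extendScalars K).toAddMonoidHom (ψ₀.extendScalars K).equivariant c = 0}))
    (fun a b h ↦ by
      simp only [Subtype.mk.injEq] at h
      exact Subtype.ext (Subtype.ext h))

end Summit.BirchSwinnertonDyer.BirchSwinnertonDyer.Theorems.InterludeWithTorsion

end
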